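import Mathlib
import HarnessLib
import Literature.Analysis.SpecialFunctions.GammaVerticalBounds

/-!
# The coefficient `(2π/i)^{s-1} Γ(1-s)` of the approximate functional equation (Titchmarsh §4.13)

Topic `Literature/NumberTheory/LFunctions`. Auxiliary file of a proof of Titchmarsh's
Theorem 4.13 (*The Theory of the Riemann Zeta-Function*, 2nd ed., §4.13). In the Hardy–Littlewood
proof the second sum of the approximate functional equation first appears with the coefficient
`(2π/i)^{s-1} Γ(1-s)` coming from "`∫_0^∞ e^{2πiνu} u^{-s} du = Γ(1-s) (2πν/i)^{s-1}`", and only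
at the end is it identified with `χ(s)`: "Also for `t > 0`,
`χ(s) = 2^s π^{s-1} sin(πs/2) Γ(1-s) = (2π/i)^{s-1} Γ(1-s) {1 + O(e^{-πt})}`."

* `Literature.AFE.afeCoeff s = (1/(-2πi))^{1-s} Γ(1-s)` (`= (2π/i)^{s-1} Γ(1-s)`), in the shape in which
  it is produced by `Literature.NumberTheory.LFunctions.AFE.norm_integral_cpow_mul_exp_sub_Gamma_le`
  (`Literature/NumberTheory/LFunctions/PowerOscillatoryIntegrals.lean`);
* `Literature.NumberTheory.LFunctions.AFE.cpow_scale_afeCoeff`: `(1/(-2πνi))^{1-s} Γ(1-s) = ν^{s-1} · afeCoeff s` (`ν > 0`);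
* `Literature.NumberTheory.LFunctions.AFE.norm_afeCoeff`: `‖afeCoeff s‖ = (2π)^{σ-1} e^{πt/2} ‖Γ(1-s)‖`;
* `Literature.NumberTheory.LFunctions.AFE.norm_Gamma_half_sub_sq`: `‖Γ(1/2 - it)‖² = π / cosh(πt)`, a corollary of the tree's
  `Literature.Analysis.SpecialFunctions.GammaVert.norm_sq_Gamma_half` (`Literature/Analysis/SpecialFunctions/GammaVerticalBounds.lean`);
* `Literature.NumberTheory.LFunctions.AFE.norm_afeCoeff_half_le_one`: `‖afeCoeff (1/2 + it)‖ ≤ 1` (indeed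
  `‖afeCoeff(1/2+it)‖² = e^{πt}/(2 cosh πt) < 1`), which is all that Bourgain's (4.3) needs.

## References

* E. C. Titchmarsh, *The Theory of the Riemann Zeta-Function*, 2nd ed. (rev. D. R. Heath-Brown),
  Oxford 1986, §4.13 (end of the proof of Theorem 4.13).
-/

noncomputable section

open Complex
open scoped Real

namespace Literature.NumberTheory.LFunctions.AFE

/-- The coefficient `(1/(-2πi))^{1-s} Γ(1-s) = (2π/i)^{s-1} Γ(1-s)` of the second sum in the
Hardy–Littlewood approximate functional equation, before its identification with Titchmarsh's
`χ(s)` (`Literature.NumberTheory.LFunctions.riemannZetaChi` of `Literature/NumberTheory/LFunctions/ZetaSubconvexity.lean`):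
the two are NOT equal, `χ(s) = afeCoeff(s) (1 + O(e^{-πt}))` (Titchmarsh §4.13, last display).
Junk values: Mathlib's `Γ` vanishes at its poles, so `afeCoeff s = 0` for `s = 1, 2, 3, …`; all
uses here are on `Re s = 1/2`. [cite: Titchmarsh1986, §4.13] -/
def afeCoeff (s : ℂ) : ℂ := (1 / (-(2 * π * I))) ^ (1 - s) * Complex.Gamma (1 - s)

/-- Unfolding lemma. [folklore] -/
theorem afeCoeff_def (s : ℂ) :
    afeCoeff s = (1 / (-(2 * π * I))) ^ (1 - s) * Complex.Gamma (1 - s) := rfl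

/-- `1/(-2πi) = i/(2π)`, a positive real multiple of `i`. [folklore] -/
theorem one_div_neg_two_pi_I : (1 : ℂ) / (-(2 * π * I)) = ((1 / (2 * π) : ℝ) : ℂ) * I := by
  have hπ : (π : ℂ) ≠ 0 := ofReal_ne_zero.2 Real.pi_ne_zero
  have h2πI : -(2 * (π : ℂ) * I) ≠ 0 := by simp [hπ, I_ne_zero]
  rw [eq_comm, eq_div_iff h2πI]
  rw [Complex.ofReal_div, Complex.ofReal_one, Complex.ofReal_mul, Complex.ofReal_ofNat]
  field_simp
  ring_nf
  rw [Complex.I_sq]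
  ring

/-- `(r z)^w = r^w z^w` for real `r > 0` (no branch problem since `arg r = 0`). [folklore] -/
theorem ofReal_mul_cpow {r : ℝ} (hr : 0 < r) {z : ℂ} (hz : z ≠ 0) (w : ℂ) :
    ((r : ℂ) * z) ^ w = (r : ℂ) ^ w * z ^ w := by
  have hr0 : (r : ℂ) ≠ 0 := ofReal_ne_zero.2 hr.ne'
  rw [cpow_def_of_ne_zero (mul_ne_zero hr0 hz), cpow_def_of_ne_zero hr0, cpow_def_of_ne_zero hz,
    Complex.log_ofReal_mul hr hz, add_mul, Complex.exp_add, Complex.ofReal_log hr.le]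

/-- **Scaling in the frequency**: for `ν > 0`,
`(1/(-2πνi))^{1-s} Γ(1-s) = ν^{s-1} · afeCoeff s` (this is how
`∫_0^∞ e^{2πiνu} u^{-s} du = ν^{s-1} ∫_0^∞ e^{2πiv} v^{-s} dv` enters). [cite: Titchmarsh1986, §4.13] -/
theorem cpow_scale_afeCoeff {ν : ℝ} (hν : 0 < ν) (s : ℂ) :
    (1 / (-(2 * π * ν * I))) ^ (1 - s) * Complex.Gamma (1 - s) = (ν : ℂ) ^ (s - 1) * afeCoeff s := by
  rw [afeCoeff, ← mul_assoc]
  congr 1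
  have hν0 : (ν : ℂ) ≠ 0 := ofReal_ne_zero.2 hν.ne'
  have hz : (1 : ℂ) / (-(2 * π * I)) ≠ 0 := by
    rw [one_div_neg_two_pi_I]
    exact mul_ne_zero (ofReal_ne_zero.2 (by positivity)) I_ne_zero
  have e1 : (1 : ℂ) / (-(2 * π * ν * I)) = ((ν⁻¹ : ℝ) : ℂ) * (1 / (-(2 * π * I))) := by
    have hπ : (π : ℂ) ≠ 0 := ofReal_ne_zero.2 Real.pi_ne_zero
    push_cast
    field_simp
  rw [e1, ofReal_mul_cpow (inv_pos.2 hν) hz]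
  congr 1
  push_cast
  rw [Complex.inv_cpow _ _ (by rw [Complex.arg_ofReal_of_nonneg hν.le]; exact Real.pi_ne_zero.symm),
    ← Complex.cpow_neg]
  congr 1; ring

/-- **The size of the coefficient**: `‖afeCoeff s‖ = (2π)^{σ-1} e^{πt/2} ‖Γ(1-s)‖`
(`s = σ + it`; `|(i/2π)^{1-s}| = (2π)^{σ-1} e^{πt/2}` since `arg(i/2π) = π/2`; implicit in the
book's "`|(2π/i)^{s-1}Γ(1-s)| y^{σ-1} = O(t^{1/2-σ} y^{σ-1})`"). [folklore] -/
theorem norm_afeCoeff (s : ℂ) :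
    ‖afeCoeff s‖ = (2 * π) ^ (s.re - 1) * Real.exp (π * s.im / 2) * ‖Complex.Gamma (1 - s)‖ := by
  rw [afeCoeff, norm_mul, one_div_neg_two_pi_I]
  congr 1
  have hr : (0 : ℝ) < 1 / (2 * π) := by positivity
  have hz : ((1 / (2 * π) : ℝ) : ℂ) * I ≠ 0 := mul_ne_zero (ofReal_ne_zero.2 hr.ne') I_ne_zero
  rw [Complex.norm_cpow_of_ne_zero hz, Complex.arg_real_mul _ hr, Complex.arg_I, norm_mul,
    Complex.norm_I, mul_one, Complex.norm_real, Real.norm_eq_abs, abs_of_pos hr]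
  simp only [sub_re, one_re, sub_im, one_im, zero_sub]
  rw [one_div, Real.inv_rpow (by positivity), ← Real.rpow_neg (by positivity), neg_sub,
    div_eq_mul_inv, ← Real.exp_neg]
  congr 2
  ring

/-- `‖Γ(1/2 - it)‖² = π / cosh(πt)`: the instance `y = -t` of the tree's
`Literature.Analysis.SpecialFunctions.GammaVert.norm_sq_Gamma_half` (`‖Γ(1/2 + iy)‖² = π/cosh(πy)`, reflection formula).
[folklore] -/
theorem norm_Gamma_half_sub_sq (t : ℝ) :
    ‖Complex.Gamma (1 / 2 - t * I)‖ ^ 2 = π / Real.cosh (π * t) := by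
  have h := Literature.Analysis.SpecialFunctions.GammaVert.norm_sq_Gamma_half (-t)
  rw [mul_neg, Real.cosh_neg] at h
  simpa [sub_eq_add_neg] using h

/-- **`‖afeCoeff (1/2 + it)‖ ≤ 1`** for every real `t`: indeed
`‖afeCoeff(1/2+it)‖² = (2π)^{-1} e^{πt} · π/cosh(πt) = e^{πt}/(e^{πt} + e^{-πt}) < 1`. (At
`σ = 1/2` this is the statement `|χ(1/2+it)| = 1 + O(e^{-πt})` of Titchmarsh §4.13 in the form
that the deduction of Bourgain's (4.3) uses.) [cite: Titchmarsh1986, §4.13] -/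
theorem norm_afeCoeff_half_le_one (t : ℝ) : ‖afeCoeff (1 / 2 + t * I)‖ ≤ 1 := by
  have h := norm_afeCoeff (1 / 2 + t * I)
  have hre : (1 / 2 + t * I : ℂ).re = 1 / 2 := by simp
  have him : (1 / 2 + t * I : ℂ).im = t := by simp
  rw [hre, him, show (1 : ℂ) - (1 / 2 + t * I) = 1 / 2 - t * I by ring] at h
  have hG := norm_Gamma_half_sub_sq t
  have hcosh : Real.exp (π * t) / 2 ≤ Real.cosh (π * t) := by
    rw [Real.cosh_eq]; have := Real.exp_pos (-(π * t)); linarith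
  have hcoshpos : 0 < Real.cosh (π * t) := Real.cosh_pos _
  -- square everything
  have hsq : ‖afeCoeff (1 / 2 + t * I)‖ ^ 2
      = (2 * π) ^ ((1 : ℝ) / 2 - 1) * (2 * π) ^ ((1 : ℝ) / 2 - 1) * Real.exp (π * t)
        * (π / Real.cosh (π * t)) := by
    rw [h, ← hG]
    have e : Real.exp (π * t / 2) * Real.exp (π * t / 2) = Real.exp (π * t) := by
      rw [← Real.exp_add]; ring_nf
    calc ((2 * π) ^ ((1 : ℝ) / 2 - 1) * Real.exp (π * t / 2) * ‖Complex.Gamma (1 / 2 - t * I)‖) ^ 2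
        = (2 * π) ^ ((1 : ℝ) / 2 - 1) * (2 * π) ^ ((1 : ℝ) / 2 - 1)
          * (Real.exp (π * t / 2) * Real.exp (π * t / 2)) * ‖Complex.Gamma (1 / 2 - t * I)‖ ^ 2 := by
          ring
      _ = _ := by rw [e]
  have h2π : (2 * π) ^ ((1 : ℝ) / 2 - 1) * (2 * π) ^ ((1 : ℝ) / 2 - 1) = (2 * π)⁻¹ := by
    rw [← Real.rpow_add (by positivity), show (1 : ℝ) / 2 - 1 + (1 / 2 - 1) = -1 by ring,
      Real.rpow_neg_one]
  rw [h2π] at hsq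
  have hle : ‖afeCoeff (1 / 2 + t * I)‖ ^ 2 ≤ 1 := by
    rw [hsq]
    have hπ : 0 < π := Real.pi_pos
    rw [show (2 * π)⁻¹ * Real.exp (π * t) * (π / Real.cosh (π * t))
        = (Real.exp (π * t) / 2) / Real.cosh (π * t) by field_simp]
    exact (div_le_one hcoshpos).2 hcosh
  have h0 : 0 ≤ ‖afeCoeff (1 / 2 + t * I)‖ := norm_nonneg _
  nlinarith [hle, h0]

end Literature.NumberTheory.LFunctions.AFE
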